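import Literature.AlgebraicGeometry.HodgeTheory.WeilClassesTwistedSquare
import HarnessLib

/-!
# On a curve with `ψ² = -d` every class of `H²` is `K`-symmetric: `ψ^*θ = d·θ`; hence so is every product class `Σ_t π_t^*o_t`

Family `hodge`, layer `Literature/AlgebraicGeometry/HodgeTheory`. A small fact-free lemma discharging, at the B2b ladder's CM anchor
`Y = E_K³(ι) × E_K³(ῑ)` (door C∘S, `LADDER.md` C50), the `K`-SYMMETRY hypothesis `φ^*θ = d·θ` of `WeilClassesSquareKSymmetric` for the product
principal polarization `θ = Σ_t π_t^*[o]` of `T = E_K³`: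

* `map_two_eq_natCast_smul_of_dim_one`: for an abelian variety `E` of dimension `1` and `ψ : E ⟶ E` with `ψ ≫ ψ = -(d • 𝟙)`, `d ≥ 1`:
  **`ψ^*θ = d·θ` for EVERY `θ ∈ H²(E(ℂ); ℂ)`** — `H² = ⋀²H¹` is the line spanned by `a ⌣ b` with `a, b` eigenvectors of `ψ^*` for `i√d`, `-i√d`,
  and `ψ^*(a ⌣ b) = (i√d)(-i√d)·(a ⌣ b) = d·(a ⌣ b)` (`ψ^*` acts on `H²(E) = H^{top}` by `deg ψ = d`);
* `map_two_eq_natCast_smul_of_intertwining`: if `π : T ⟶ E` intertwines `φ` on `T` with `ψ` (`π ≫ ψ = φ ≫ π`), then `φ^*(π^*o) = d·π^*o`;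
  `map_two_sum_eq_natCast_smul_of_intertwining`: the same for `Σ_t π_t^*o_t` — the product polarization of `E³` with the diagonal
  `K`-action is `K`-symmetric.

All proved on the real carriers (exterior algebra on `H¹`, `Motives.AbelianVariety.hasExteriorCohomologyH1_complexPoints`); no named fact, no
definition, not a rung.

## References

* [vanGeemen1994HodgeAV] B. van Geemen, LNM 1594 (1994), Lemma 5.2 (2)–(3), 5.3.
* [LangeBirkenhake1992] H. Lange, Ch. Birkenhake, Complex Abelian Varieties (1992), Lemma 1.1.17, §5.1.
-/

noncomputable section

open CategoryTheory

namespace Literature.AlgebraicGeometry.HodgeTheory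

open Literature.AlgebraicTopology.SingularHomology
open Literature.AlgebraicGeometry.Motives

section HodgeTheory

variable {E T : Motives.AbelianVariety ℂ} {d : ℕ}

/-- **On a curve, `ψ^*` acts on `H²` by the degree: `ψ ≫ ψ = -d` ⟹ `ψ^*θ = d·θ` for every `θ ∈ H²(E(ℂ); ℂ)`** (`dim E = 1`): `H²(E) = ⋀²H¹(E)`
is spanned by `a ⌣ b` with `ψ^*a = i√d·a`, `ψ^*b = -i√d·b`, and `ψ^*(a ⌣ b) = d·(a ⌣ b)`. [cite: vanGeemen1994HodgeAV, Lemma 5.2 and 5.3]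
[cite: LangeBirkenhake1992, Lemma 1.1.17] -/
theorem map_two_eq_natCast_smul_of_dim_one (hE : E.dim = 1) (hd : 0 < d) {ψ : E ⟶ E} (hψ : ψ ≫ ψ = -(d • 𝟙 E))
    (θ : complexBetti E.X 2) : complexBetti.map ψ.hom.hom.hom 2 θ = (d : ℂ) • θ := by
  classical
  set μ : ℂ := Complex.I * (Real.sqrt d : ℂ) with hμ
  set Tψ := (complexBetti.map ψ.hom.hom.hom 1).hom with hTψ
  haveI := finite_complexBetti_abelianVariety E 1
  have hb₁ : Module.finrank ℂ (complexBetti E.X 1) = 2 := by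
    rw [AbelianVariety.finrank_complexBetti_one, hE]
  -- `dim V₊ = dim V₋ = 1`
  have hp : Module.finrank ℂ (Module.End.eigenspace Tψ μ) = 1 := by
    have h := two_mul_finrank_eigenspace_eq hd hψ
    rw [hb₁] at h
    change 2 * Module.finrank ℂ (Module.End.eigenspace Tψ μ) = 2 at h
    omega
  have hq : Module.finrank ℂ (Module.End.eigenspace Tψ (-μ)) = 1 := by
    have h := finrank_eigenspace_eq_finrank_eigenspace_neg hd hψ
    change Module.finrank ℂ (Module.End.eigenspace Tψ μ) = Module.finrank ℂ (Module.End.eigenspace Tψ (-μ)) at h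
    rw [← h, hp]
  -- an eigenbasis `(a, b)` of `H¹(E)`
  let bp := Module.finBasisOfFinrankEq ℂ (Module.End.eigenspace Tψ μ) hp
  let bm := Module.finBasisOfFinrankEq ℂ (Module.End.eigenspace Tψ (-μ)) hq
  have hcompl : IsCompl (Module.End.eigenspace Tψ μ) (Module.End.eigenspace Tψ (-μ)) :=
    isCompl_eigenspace_eigenspace_neg hd hψ
  let bb₀ : Module.Basis (Fin 1 ⊕ Fin 1) ℂ (complexBetti E.X 1) :=
    (bp.prod bm).map (Submodule.prodEquivOfIsCompl _ _ hcompl)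
  let bb : Module.Basis (Fin (1 + 1)) ℂ (complexBetti E.X 1) := bb₀.reindex finSumFinEquiv
  have hbb0 : bb 0 = (bp 0 : complexBetti E.X 1) := by
    have : (0 : Fin (1 + 1)) = Fin.castAdd 1 (0 : Fin 1) := rfl
    rw [this, Module.Basis.reindex_apply, finSumFinEquiv_symm_apply_castAdd]
    simp only [Sum.elim_inl, bb₀, Module.Basis.map_apply, Module.Basis.prod_apply, Function.comp_apply,
      LinearMap.inl_apply, Submodule.coe_prodEquivOfIsCompl', Submodule.coe_zero, add_zero]
  have hbb1 : bb 1 = (bm 0 : complexBetti E.X 1) := by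
    have : (1 : Fin (1 + 1)) = Fin.natAdd 1 (0 : Fin 1) := rfl
    rw [this, Module.Basis.reindex_apply, finSumFinEquiv_symm_apply_natAdd]
    simp only [Sum.elim_inr, bb₀, Module.Basis.map_apply, Module.Basis.prod_apply, Function.comp_apply,
      LinearMap.inr_apply, Submodule.coe_prodEquivOfIsCompl', Submodule.coe_zero, zero_add]
  have hΛ := AbelianVariety.hasExteriorCohomologyH1_complexPoints E
  -- the top class `w = a ⌣ b ≠ 0` spans `H²(E)`
  have hw0 : cupPowOne ℂ (Motives.ComplexPoints E.X) (1 + 1) bb ≠ 0 := cupPowOne_basis_ne_zero hΛ bb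
  have hE2 : E.dim = 1 := hE
  obtain ⟨c, hc⟩ := exists_smul_eq_of_degree_top' hE2 hw0 θ
  -- `ψ^*` acts on `a ⌣ b` by `μ · (-μ) = d`
  have heig : ∀ i : Fin (1 + 1), bb i ∈ Module.End.eigenspace Tψ ((![μ, -μ] : Fin (1 + 1) → ℂ) i) := by
    refine Fin.forall_fin_two.2 ⟨?_, ?_⟩
    · rw [Matrix.cons_val_zero, hbb0]; exact (bp 0).2
    · rw [Matrix.cons_val_one, Matrix.cons_val_zero, hbb1]; exact (bm 0).2
  have hmem := cupPowOne_mem_pullbackEigenclasses (A := E) (φ := ψ) (lam := (![μ, -μ] : Fin (1 + 1) → ℂ)) (v := bb) heig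
  have hψw : complexBetti.map ψ.hom.hom.hom (1 + 1) (cupPowOne ℂ (Motives.ComplexPoints E.X) (1 + 1) bb) =
      (d : ℂ) • cupPowOne ℂ (Motives.ComplexPoints E.X) (1 + 1) bb := by
    have h := (mem_pullbackEigenclasses_iff.mp hmem) 0 1
    rw [zero_smul, one_smul, zero_add] at h
    have eχ : (∏ i : Fin (1 + 1), (((0 : ℕ) : ℂ) + ((1 : ℕ) : ℂ) * (![μ, -μ] : Fin (1 + 1) → ℂ) i)) = (d : ℂ) := by
      rw [Fin.prod_univ_two, Matrix.cons_val_zero, Matrix.cons_val_one, Matrix.cons_val_zero, Nat.cast_zero, Nat.cast_one, zero_add,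
        zero_add, one_mul, one_mul, mul_neg, ← pow_two, hμ, I_mul_sqrt_sq, neg_neg]
    rw [eχ] at h
    exact h
  rw [← hc, map_smul]
  change c • complexBetti.map ψ.hom.hom.hom (1 + 1) (cupPowOne ℂ (Motives.ComplexPoints E.X) (1 + 1) bb) = _
  rw [hψw, smul_comm]
where
  /-- Top degree of a curve is a line: every class of `H²(E)` is a multiple of a non-zero one. [folklore] -/
  exists_smul_eq_of_degree_top' {E : Motives.AbelianVariety ℂ} (hE : E.dim = 1) {y : complexBetti E.X (1 + 1)} (hy : y ≠ 0)
      (x : complexBetti E.X (1 + 1)) : ∃ a : ℂ, a • y = x := by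
    haveI := finite_complexBetti_abelianVariety E 1
    have hΛ := AbelianVariety.hasExteriorCohomologyH1_complexPoints E
    have h1 : Module.finrank ℂ (complexBetti E.X (1 + 1)) = 1 := by
      have h := hΛ.finrank_eq (1 + 1)
      rw [AbelianVariety.finrank_complexBetti_one, hE] at h
      exact h
    exact (finrank_eq_one_iff_of_nonzero' y hy).1 h1 x

/-- **Pull-backs from a CM curve are `K`-symmetric**: if `π : T ⟶ E` intertwines `φ` on `T` with `ψ` on the curve `E` (`π ≫ ψ = φ ≫ π`,
`ψ ≫ ψ = -d`), then `φ^*(π^*o) = d·π^*o` for every `o ∈ H²(E(ℂ); ℂ)`. [cite: vanGeemen1994HodgeAV, 5.3] -/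
theorem map_two_eq_natCast_smul_of_intertwining (hE : E.dim = 1) (hd : 0 < d) {ψ : E ⟶ E} (hψ : ψ ≫ ψ = -(d • 𝟙 E))
    {φ : T ⟶ T} {π : T ⟶ E} (hπ : π ≫ ψ = φ ≫ π) (o : complexBetti E.X 2) :
    complexBetti.map φ.hom.hom.hom 2 (complexBetti.map π.hom.hom.hom 2 o) = (d : ℂ) • complexBetti.map π.hom.hom.hom 2 o := by
  rw [complexBetti_map_map_hom, ← hπ, ← complexBetti_map_map_hom, map_two_eq_natCast_smul_of_dim_one hE hd hψ o, map_smul]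

/-- **The product polarization of `E^n` with the diagonal `K`-action is `K`-symmetric**: `φ^*(Σ_t π_t^*o_t) = d·Σ_t π_t^*o_t` when every
`π_t : T ⟶ E` intertwines `φ` with `ψ`, `ψ ≫ ψ = -d`, `dim E = 1` — the hypothesis `φ^*θ = d·θ` of `WeilClassesSquareKSymmetric` at the B2b
ladder's CM anchor `T = E_K³`, `θ = Σ_t π_t^*[o]`. [cite: vanGeemen1994HodgeAV, 5.3] -/
theorem map_two_sum_eq_natCast_smul_of_intertwining {ι : Type*} (s : Finset ι) (hE : E.dim = 1) (hd : 0 < d) {ψ : E ⟶ E}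
    (hψ : ψ ≫ ψ = -(d • 𝟙 E)) {φ : T ⟶ T} {π : ι → (T ⟶ E)} (hπ : ∀ t, π t ≫ ψ = φ ≫ π t) (o : ι → complexBetti E.X 2) :
    complexBetti.map φ.hom.hom.hom 2 (∑ t ∈ s, complexBetti.map (π t).hom.hom.hom 2 (o t)) =
      (d : ℂ) • ∑ t ∈ s, complexBetti.map (π t).hom.hom.hom 2 (o t) := by
  rw [map_sum, Finset.smul_sum]
  exact Finset.sum_congr rfl fun t _ => map_two_eq_natCast_smul_of_intertwining hE hd hψ (hπ t) (o t)

end HodgeTheory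

end Literature.AlgebraicGeometry.HodgeTheory

end
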